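import Mathlib.RingTheory.Depth.Rees
import Mathlib.RingTheory.Regular.LinearMap
import Mathlib.RingTheory.Ideal.KrullsHeightTheorem
import Mathlib.RingTheory.IntegralClosure.IntegrallyClosed
import Mathlib.RingTheory.IntegralClosure.Algebra.Basic
import Mathlib.RingTheory.Localization.FractionRing
import HarnessLib

/-!
# A normal noetherian local domain of dimension `≥ 2` has depth `≥ 2` (chain W4.4, input of CA2)

`[OURS · L W4.4 ∩ W4.4b]` Crux `HomologicalConductor.NoZenoR` (stmt-ResolutionOfSingularities-19943),
line `sandwich-cluster`, S3 Layer 2 CA-layer: commutative-algebra input of target **CA2**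
(`ext_one_eq_zero_of_dual_syzygy_of_reflexive`, res-L0-w44-plan-1 CRUX-PLAN v5 §A; second consumer
rung S-2 `PersistenceSurface` stmt-ResolutionOfSingularities-19970, programme M-rat (IW-p)). Replaces the
role of no printed item of the manuscript under review; pure commutative algebra (Serre's `(S₂)` half of
"normal ⟹ `(R₁) + (S₂)`" at the maximal ideal); AI-written (weaker than expert review).

## Contents

For `T` a noetherian local NORMAL domain whose maximal ideal `𝔪` has height `> 1`:

* `mem_span_singleton_of_maximalIdeal_mul_le` — the key lemma: if `x ∈ 𝔪`, `x ≠ 0` and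
  `𝔪 · y ⊆ (x)` then `y ∈ (x)`. (Else `u := y/x ∉ T` has `u𝔪 ⊆ T`; if `u𝔪 ⊆ 𝔪` then `u` is integral
  over `T` by the determinant trick, so `u ∈ T` by normality — contradiction; if some `u·m` is a unit
  then `𝔪 = (m)` is principal and Krull's principal ideal theorem gives `ht 𝔪 ≤ 1` — contradiction.)
* `subsingleton_linearMap_residueField_quotSMulTop` — hence `Hom_T(T/𝔪, T/xT) = 0`;
* `exists_isRegular_pair` — `𝔪` contains a `T`-regular sequence of length two;
* `subsingleton_ext_of_support_subset` — **grade consequence** (via Mathlib's Rees theorem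
  `ModuleCat.subsingleton_ext_of_exists_isRegular`): for every finitely generated `T`-module `N`
  supported on `{𝔪}`, `Extⁱ_T(N, T) = 0` for `i < 2`.

[folklore; cf. Matsumura, *Commutative Ring Theory*, Thm. 11.5 (i) / Thm. 23.8 (Serre's criterion),
Bruns–Herzog Thm. 2.2.22]
-/

-- single-problem summit: the doubled namespace component `ResolutionOfSingularities` is forced
set_option linter.dupNamespace false

noncomputable section

open IsLocalRing

universe u

namespace Summit.ResolutionOfSingularities.ResolutionOfSingularities.Theorems.NoZeno.SandwichCluster

variable {T : Type u} [CommRing T] [IsDomain T] [IsNoetherianRing T] [IsLocalRing T]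
  [IsIntegrallyClosed T]

/-- **Key lemma (`(S₂)` at the maximal ideal of a normal local domain).** If the maximal ideal `𝔪`
of a noetherian local normal domain `T` has height `> 1`, `x ∈ 𝔪` is nonzero and `m * y ∈ (x)` for every
`m ∈ 𝔪`, then `y ∈ (x)`. [folklore; cf. Matsumura Thm. 11.5] -/
theorem mem_span_singleton_of_maximalIdeal_mul_le (hT : ¬ (maximalIdeal T).height ≤ 1)
    {x y : T} (hx : x ∈ maximalIdeal T) (hx0 : x ≠ 0)
    (hy : ∀ m ∈ maximalIdeal T, m * y ∈ Ideal.span {x}) : y ∈ Ideal.span {x} := by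
  classical
  by_contra hyx
  have hy0 : y ≠ 0 := fun h => hyx (h ▸ Submodule.zero_mem _)
  by_cases hB : ∃ m ∈ maximalIdeal T, ∃ t : T, t * x = m * y ∧ IsUnit t
  · -- Case B: `𝔪 = (m)` is principal, contradicting `ht 𝔪 > 1`
    obtain ⟨m, hm, t, hmt, ⟨v, rfl⟩⟩ := hB
    have hmax : maximalIdeal T = Ideal.span {m} := by
      refine le_antisymm (fun z hz => ?_) ((Ideal.span_singleton_le_iff_mem _).mpr hm)
      obtain ⟨w, hw⟩ := Ideal.mem_span_singleton'.mp (hy z hz)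
      -- from `v x = m y` and `w x = z y`: `y (z v) = y (m w)`, so `z v = m w`
      have hzv : z * ↑v = m * w := by
        apply mul_left_cancel₀ hy0
        calc y * (z * ↑v) = (z * y) * ↑v := by ring
          _ = (w * x) * ↑v := by rw [hw]
          _ = w * (↑v * x) := by ring
          _ = w * (m * y) := by rw [hmt]
          _ = y * (m * w) := by ring
      refine Ideal.mem_span_singleton'.mpr ⟨w * ↑v⁻¹, ?_⟩
      calc w * ↑v⁻¹ * m = (m * w) * ↑v⁻¹ := by ring
        _ = z * ↑v * ↑v⁻¹ := by rw [← hzv]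
        _ = z := by rw [mul_assoc, Units.mul_inv, mul_one]
    apply hT
    haveI : (maximalIdeal T).IsPrincipal := ⟨⟨m, hmax⟩⟩
    exact Ideal.height_le_one_of_isPrincipal_of_mem_minimalPrimes (maximalIdeal T)
      (maximalIdeal T) (by rw [Ideal.minimalPrimes_eq_subsingleton_self]; exact Set.mem_singleton _)
  · -- Case A: `u := y / x` stabilises `𝔪`, hence is integral over `T`, hence lies in `T`
    push Not at hB
    let K := FractionRing T
    have hxK : algebraMap T K x ≠ 0 := IsFractionRing.to_map_eq_zero_iff.not.mpr hx0
    let u : K := algebraMap T K y / algebraMap T K x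
    let M : Submodule T K := Submodule.map (Algebra.linearMap T K) (maximalIdeal T)
    have hu : ∀ n ∈ M, u • n ∈ M := by
      rintro _ ⟨m, hm, rfl⟩
      obtain ⟨t, ht⟩ := Ideal.mem_span_singleton'.mp (hy m hm)
      have htm : t ∈ maximalIdeal T := by
        by_contra htu
        exact hB m hm t ht (IsLocalRing.notMem_maximalIdeal.mp htu)
      refine ⟨t, htm, ?_⟩
      change algebraMap T K t = u • algebraMap T K m
      rw [smul_eq_mul, div_mul_eq_mul_div, eq_div_iff hxK, ← map_mul, ← map_mul, ht, mul_comm]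
    have hMne : M ≠ ⊥ := by
      rw [Submodule.ne_bot_iff]
      exact ⟨algebraMap T K x, ⟨x, hx, rfl⟩, hxK⟩
    have hMfg : M.FG := (IsNoetherian.noetherian _).map _
    have hint : IsIntegral T u := isIntegral_of_smul_mem_submodule M hMne hMfg u hu
    obtain ⟨t, ht⟩ := IsIntegrallyClosed.algebraMap_eq_of_integral hint
    apply hyx
    refine Ideal.mem_span_singleton'.mpr ⟨t, ?_⟩
    apply IsFractionRing.injective T K
    rw [map_mul, ht, div_mul_cancel₀ _ hxK]

/-- `Hom_T(T/𝔪, T/xT) = 0` for `x ∈ 𝔪` nonzero, when `ht 𝔪 > 1` (normal local domain). [folklore] -/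
theorem subsingleton_linearMap_residueField_quotSMulTop (hT : ¬ (maximalIdeal T).height ≤ 1)
    {x : T} (hx : x ∈ maximalIdeal T) (hx0 : x ≠ 0) :
    Subsingleton ((T ⧸ maximalIdeal T) →ₗ[T] QuotSMulTop x T) := by
  refine subsingleton_of_forall_eq 0 fun f => ?_
  -- `f` is determined by `f 1`, and `𝔪 • f 1 = 0`
  obtain ⟨y, hy⟩ := Submodule.Quotient.mk_surjective _ (f (Ideal.Quotient.mk _ 1))
  have hann : ∀ m ∈ maximalIdeal T, m * y ∈ Ideal.span {x} := by
    intro m hm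
    have h1 : m • f (Ideal.Quotient.mk _ 1) = 0 := by
      rw [← map_smul, ← Ideal.Quotient.mk_eq_mk, ← Submodule.Quotient.mk_smul,
        (Submodule.Quotient.mk_eq_zero _).mpr (by simpa [smul_eq_mul] using hm), map_zero]
    rw [← hy, ← Submodule.Quotient.mk_smul, Submodule.Quotient.mk_eq_zero, smul_eq_mul] at h1
    -- `m * y ∈ x • ⊤`
    obtain ⟨z, -, hz⟩ := Submodule.mem_smul_pointwise_iff_exists _ _ _|>.mp h1
    exact Ideal.mem_span_singleton'.mpr ⟨z, by simpa [smul_eq_mul, mul_comm] using hz⟩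
  have hyx : y ∈ Ideal.span {x} := mem_span_singleton_of_maximalIdeal_mul_le hT hx hx0 hann
  have hf1 : f (Ideal.Quotient.mk _ 1) = 0 := by
    rw [← hy, Submodule.Quotient.mk_eq_zero]
    obtain ⟨c, hc⟩ := Ideal.mem_span_singleton'.mp hyx
    exact Submodule.mem_smul_pointwise_iff_exists _ _ _|>.mpr ⟨c, Submodule.mem_top, by
      simp [smul_eq_mul, ← hc, mul_comm]⟩
  ext
  simpa using hf1

/-- **Depth `≥ 2`:** the maximal ideal of a noetherian local normal domain of dimension `≥ 2` contains
a `T`-regular sequence of length two. [folklore; Serre's criterion, cf. Matsumura Thm. 23.8] -/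
theorem exists_isRegular_pair (hT : ¬ (maximalIdeal T).height ≤ 1) :
    ∃ x ∈ maximalIdeal T, ∃ y ∈ maximalIdeal T, RingTheory.Sequence.IsRegular T [x, y] := by
  -- a nonzero `x ∈ 𝔪`
  have hm0 : maximalIdeal T ≠ ⊥ := by
    intro h
    apply hT
    rw [h, Ideal.height_bot]  -- height ⊥ = 0
    exact zero_le_one
  obtain ⟨x, hx, hx0⟩ := Submodule.exists_mem_ne_zero_of_ne_bot hm0
  have hxreg : IsSMulRegular T x := IsSMulRegular.of_ne_zero hx0  -- domain
  -- a `T/xT`-regular `y ∈ 𝔪 = Ann (T/𝔪)`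
  haveI := subsingleton_linearMap_residueField_quotSMulTop hT hx hx0
  obtain ⟨y, hy, hyreg⟩ :=
    (IsSMulRegular.subsingleton_linearMap_iff (R := T) (N := T ⧸ maximalIdeal T)
      (M := QuotSMulTop x T)).mp inferInstance
  rw [Ideal.annihilator_quotient] at hy
  refine ⟨x, hx, y, hy, ?_⟩
  refine ⟨(RingTheory.Sequence.isWeaklyRegular_cons_iff T x [y]).mpr ⟨hxreg,
    (RingTheory.Sequence.isWeaklyRegular_cons_iff _ y []).mpr ⟨hyreg,
      RingTheory.Sequence.IsWeaklyRegular.nil _ _⟩⟩, ?_⟩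
  -- `T ≠ (x, y) T`
  intro htop
  have hle : Ideal.ofList [x, y] ≤ maximalIdeal T := by
    rw [Ideal.ofList, Ideal.span_le]
    intro r hr
    simp only [List.mem_cons, List.not_mem_nil, or_false, Set.mem_setOf_eq] at hr
    rcases hr with rfl | rfl
    · exact hx
    · exact hy
  have heq : Ideal.ofList [x, y] • (⊤ : Submodule T T) = Ideal.ofList [x, y] := by
    rw [Ideal.smul_eq_mul, Ideal.mul_top]
  rw [heq] at htop
  exact (maximalIdeal.isMaximal T).ne_top (top_le_iff.mp (htop.le.trans hle))


open CategoryTheory Abelian in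
/-- **Grade `≥ 2` for modules supported at the closed point.** Over a noetherian local normal domain
`T` with `ht 𝔪 > 1`, every finitely generated module `N` with `Supp N ⊆ {𝔪}` has
`Extⁱ_T(N, T) = 0` for `i < 2` (Rees: `𝔪` contains a `T`-regular pair, `exists_isRegular_pair`).
[folklore; cf. Bruns–Herzog Thm. 1.2.5 / Rees] -/
theorem subsingleton_ext_of_support_subset (hT : ¬ (maximalIdeal T).height ≤ 1)
    (N : ModuleCat.{u} T) [Module.Finite T N]
    (hN : Module.support T N ⊆ PrimeSpectrum.zeroLocus (maximalIdeal T)) :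
    ∀ i < 2, Subsingleton (Ext N (ModuleCat.of T T) i) := by
  obtain ⟨x, hx, y, hy, hreg⟩ := exists_isRegular_pair hT
  have hlt : maximalIdeal T • (⊤ : Submodule T (ModuleCat.of T T)) < ⊤ := by
    change maximalIdeal T • (⊤ : Submodule T T) < ⊤
    rw [Ideal.smul_eq_mul, Ideal.mul_top]
    exact lt_top_iff_ne_top.mpr (maximalIdeal.isMaximal T).ne_top
  have hmem : ∀ r ∈ [x, y], r ∈ maximalIdeal T := by
    intro r hr
    simp only [List.mem_cons, List.not_mem_nil, or_false] at hr
    rcases hr with rfl | rfl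
    · exact hx
    · exact hy
  exact ModuleCat.subsingleton_ext_of_exists_isRegular (maximalIdeal T) N hN (ModuleCat.of T T) hlt
    [x, y] hmem hreg

end Summit.ResolutionOfSingularities.ResolutionOfSingularities.Theorems.NoZeno.SandwichCluster

end
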